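import Mathlib
import HarnessLib
import Summits.KontsevichZagierPeriods.Zeta5Search.TwoTaleRungALineDecay
import Summits.KontsevichZagierPeriods.Zeta5Search.Denom.RungALineCertificate
import Summits.KontsevichZagierPeriods.Zeta5Search.Denom.TwoTaleP15DecayHolds
import Summits.KontsevichZagierPeriods.Zeta5Search.TwoTaleWhippleDischarged
import Summits.KontsevichZagierPeriods.Zeta5Search.TwoTaleRungAInclusion

/-!
# Rung A `(6,5,4,7 | 0,1,2,12)`: `DecayA 13.229` PROVED, and `μ(ζ(2)) ≤ 5.2053` unconditionally

HONEST FRAMING: systematic search; no irrationality claim unless certified.  Cell pub-zeta5, class `measure`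
(fam-measure g4 with fam-denom g7 and P1 g9), T3/T4.  This file closes the LAST named input of the kernel T3 chain at
Zudilin's Remark-3 rung ([Zudilin2014ZetaTwo], arXiv:1310.1526, §3 Remark 3: `a = (6n+1, 5n+1, 4n+1, 7n+1)`,
`b = (1, n+1, 2n+1, 12n+2)`): the decay `|qₙ ζ(2) − pₙ| ≤ e^{−13.229 n}` eventually (`Denom.TwoTaleR3Forms.DecayA 13.229`).

* `rateA_eq` — fam-measure's rate function `TwoTaleRungALine.rateA` (P1's `prim`-normalisation) IS fam-denom's
  `profileA0 (23/10)` (`gPrim`-normalisation): `simp` + `norm_num` + `ring`;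
* `decayA_of_lt : c < 13.22912 → DecayA c` — fam-denom's kernel interval certificate
  `RungALineCertificate.certA_delta` (two-point tangent test, `decide +kernel`, slack `6δ`) fed into
  `TwoTaleRungALine.decayA_of_certificate` with `δ = min 4 ((13.22912 − c)/12)`;
* **`decayA_holds : DecayA 13.229`**, `decayA_holds_sharp : DecayA 13.2291`, `decayA_holds_loose : DecayA 13.2`;
* **`zetaTwo_exponent_le_A_holds : ExponentLE (zetaValue 2) 5.2053`** — the tree theorem
  `TwoTaleWhipple.zetaTwo_exponent_le_A : InclusionA → DecayA 13.229 → ExponentLE (zetaValue 2) 5.2053`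
  (Nesterenko criterion + Zudilin's Prop. 1/Lemmas 4–5 arithmetic + the Whipple growth side, all tree) with BOTH inputs
  now theorems (`TwoTaleRungA.inclusionA_holds`, `decayA_holds`).

WHAT THIS IS AND IS NOT.  It is a kernel-checked irrationality MEASURE bound `μ(π²) = μ(ζ(2)) ≤ 5.2053`, i.e. Zudilin's
printed `5.20514736…` (2014, Remark 3) rounded up — a certified reproduction of a published, non-record bound (the
record is `μ(π²) ≤ 5.0954…`, Zudilin 2014, Theorem 1, which needs the second tale).  It is NOT an irrationality proof of
anything new (π² is transcendental), NOT a record, and claims nothing about `ζ(5)`.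
-/

noncomputable section

open Real Set
open Literature.NumberTheory.Transcendental
open Summit.KontsevichZagierPeriods.Zeta5Search
open Summit.KontsevichZagierPeriods.Zeta5Search.Denom.TwoTaleR3Forms
open Summit.KontsevichZagierPeriods.Zeta5Search.Denom.LineProfile
open Summit.KontsevichZagierPeriods.Zeta5Search.Denom.RungALineProfileShape
open Summit.KontsevichZagierPeriods.Zeta5Search.Denom.RungALineCertificate
open Summit.KontsevichZagierPeriods.Zeta5Search.Denom.TwoTaleP15DecayHolds (prim_eq_gPrim)
open Summit.KontsevichZagierPeriods.Zeta5Search.TwoTaleLineBound (prim)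
open Summit.KontsevichZagierPeriods.Zeta5Search.TwoTaleRungALine

namespace Summit.KontsevichZagierPeriods.Zeta5Search.TwoTaleRungADecayHolds

/-- **The two normalisations agree**: `rateA η = profileA0 (23/10) η`
(`V* = 23/10 + (1, −5 | 0, −4 | −1, −3 ‖ 7, 2)`, `7 + κ_A = profileAConst`). -/
theorem rateA_eq (η : ℝ) : rateA η = profileA0 (23 / 10) η := by
  simp only [rateA, kappaA, profileA0, profileAConst, prim_eq_gPrim]
  norm_num
  ring

/-- **`DecayA c` for every `c < 13.22912`** (fam-denom's certificate + fam-measure's `dy`-assembly). -/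
theorem decayA_of_lt {c : ℝ} (hc : c < 13.22912) : DecayA c := by
  have hδ0 : 0 < min 4 ((13.22912 - c) / 12) := lt_min (by norm_num) (by linarith)
  have hδ4 : min 4 ((13.22912 - c) / 12) ≤ 4 := min_le_left _ _
  have hδc : min 4 ((13.22912 - c) / 12) ≤ (13.22912 - c) / 12 := min_le_right _ _
  refine decayA_of_certificate hδ0 (M := -13.22912 + 6 * min 4 ((13.22912 - c) / 12)) (fun η hη => ?_) (by linarith)
  rw [rateA_eq]
  exact certA_delta hδ0.le hδ4 η hη

/-- **`DecayA 13.229` PROVED** — the decay input of `TwoTaleWhipple.zetaTwo_exponent_le_A`. -/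
theorem decayA_holds : DecayA 13.229 := decayA_of_lt (by norm_num)

/-- `DecayA 13.2` (the loose constant of `TwoTaleWhipple.zetaTwo_exponent_le_A_loose`). -/
theorem decayA_holds_loose : DecayA 13.2 := decayA_of_lt (by norm_num)

/-- `DecayA 13.2291` (the model value on the rational line `ξ = 23/10` is `C₀(A) = 13.229124…`). -/
theorem decayA_holds_sharp : DecayA 13.2291 := decayA_of_lt (by norm_num)

/-- **`μ(ζ(2)) ≤ 5.2053`, UNCONDITIONAL** (Zudilin 2014, Remark 3: printed `5.20514736…`; a certified reproduction of
a published non-record measure of `π²`, not a new result): both named inputs of the tree theorem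
`TwoTaleWhipple.zetaTwo_exponent_le_A` are theorems. -/
theorem zetaTwo_exponent_le_A_holds : ExponentLE (zetaValue 2) 5.2053 :=
  TwoTaleWhipple.zetaTwo_exponent_le_A TwoTaleRungA.inclusionA_holds decayA_holds

/-- The loose companion `μ(ζ(2)) ≤ 5.233`, unconditional (`TwoTaleWhipple.zetaTwo_exponent_le_A_loose`). -/
theorem zetaTwo_exponent_le_A_loose_holds : ExponentLE (zetaValue 2) 5.233 :=
  TwoTaleWhipple.zetaTwo_exponent_le_A_loose TwoTaleRungA.inclusionA_holds decayA_holds_loose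

end Summit.KontsevichZagierPeriods.Zeta5Search.TwoTaleRungADecayHolds

end
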